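/-
Copyright (c) 2026 the pub-hodgecm-mathlib formalisation cell (harness21).  Prover seat hodgecm-mathlib-LH4-p01 (g17), STAGE 1a «(D-RAM) FOUR-FRAME» squad of crux H413 (heir
LEAD F0P3a-plan T17-31 (R-9) TIER 2; desk INVENTORY v1 §U0 row `stub_U0_d_t_unique`; assembler U0 = this seat).  2026-09-03.
-/
import Literature.NumberTheory.Automorphic.UnitaryThreeFourFrameDefs                  -- ★ #0a (B-p04): the datum token `IsRamifiedQuadraticDatum σ ϖ d t`
import Literature.NumberTheory.Automorphic.UnitaryLatticeTreeSelfDualTransitiveWild    -- ★ p854568 (this seat): `v_map_sub_self_lt_one_of_even`'s decomposition; brings `CartanUnique.v_uniformizer_pow`, `uniformizer_ne_zero`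
import HarnessLib

/-!
# F0 · P3c · line LH4 «(D-RAM) FOUR-FRAME» — unit U0, TIER 2: THE RAMIFIED QUADRATIC DATUM IS INTRINSIC — `d` and `t` of `IsRamifiedQuadraticDatum σ ϖ d t` do not depend on
# the uniformiser (the statement of the tier-1 stub `stub_U0_d_t_unique` of `Cruxes/H413/Lines/F0_P3c_DyRamFourFrame/U0_WildTree.lean`, PROVED)

Cell `pub/hodgecm-mathlib`, crux H413 = `stmt-HodgeConjecture-24833` (helper lane `--supports stmt-HodgeConjecture-24833 --as helper`), route HCCMUnconditional; THEOREMS ONLY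
(no definition, no instance, no notation, no named fact, no `sorry`).  Dealer #12 clause ∕ ref4 R4-71 (T1): the line's level token `M(w) = m*(d)` must not depend on the
uniformiser through which `d` is read; at a CM place this is ★ LH4-p02 `eq_of_isRamifiedQuadraticDatum_of_placesOver`, HERE it is proved over the ABSTRACT datum.

THE MATHEMATICS.  `t`: `|2| = |ϖ|^t = exp(−t)` pins `t`.  `d`: with `u := ϖ′∕ϖ` (a unit), `ϖ′ − σϖ′ = u(ϖ − σϖ) + σϖ·(u − σu)`; the RESIDUAL DEPTH of `σ` is `d` —
`|σx − x| ≤ |ϖ|^d` for every `x ∈ 𝒪` (§1: `x = α + βϖ` with `σ`-fixed `α, β`, `β = (x − σx)∕(ϖ − σϖ)`, and `|β| ≤ 1` by the parity of valuations, exactly as in ★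
`v_map_sub_self_lt_one_of_even`) — so the second term has valuation `≤ exp(−1−d) < exp(−d) = ` that of the first, and `|ϖ′ − σϖ′| = exp(−d)` (§2).

* §1 `v_map_sub_self_le_pow_of_even` — residual depth `d`: `|x| ≤ 1 ⇒ |σx − x| ≤ |ϖ|^d` (sharpens ★ `v_map_sub_self_lt_one_of_even`).
* §2 `v_sub_map_eq_of_uniformizer` — `|ϖ′ − σϖ′| = |ϖ − σϖ|` for any two uniformisers; **`d_t_unique`** — THE HEAD = `stub_U0_d_t_unique`'s statement token for token.

HONEST LABEL: HC_CM is proved only modulo the 7 printed citations (2 remaining named inputs: hLiu418 = stmt-HodgeConjecture-24832, h413 = stmt-HodgeConjecture-24833) until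
rung 0 closes; this file pays ONE tier-1 stub of unit U0 (count-neutral until the line closes its organ).

## References
* [Serre1979] J.-P. Serre, *Local Fields* (1979), Ch. III §6 Prop. 13 and Remark (the different `𝔇 = (f′(π))` of a totally ramified extension does not depend on the prime element),
  Ch. IV §1 Prop. 4 (`i_G(σ) + 1 = v(σπ − π)` for any prime `π`).
* [Jacobowitz1962] R. Jacobowitz, *Hermitian forms over local fields*, Amer. J. Math. 84 (1962), §9 (ramified dyadic: the invariants of `E∕F`).
-/

set_option autoImplicit false

noncomputable section

open scoped Valued WithZero

namespace Summit.HodgeConjecture.HodgeConjecture.Cruxes.H413.F0P3cDyRamU0DatumUnique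

open Literature.NumberTheory.Automorphic Literature.NumberTheory.Automorphic.UnitaryThreeFourFrame Literature.NumberTheory.Automorphic.CartanUnique

variable {K : Type} [Field K] [Valued K ℤᵐ⁰] {σ : K →+* K} {ϖ : K} {d : ℕ}

/-! ## §1 The residual depth of `σ` is `d` -/

/-- **RESIDUAL DEPTH `d`**: if the `σ`-fixed elements have even valuation and `|ϖ − σϖ| = |ϖ|^d`, then `|σx − x| ≤ |ϖ|^d` for every `x ∈ 𝒪` — write `x = α + βϖ` with
`β = (x − σx)∕(ϖ − σϖ)` and `α` both `σ`-fixed; `|βϖ| ≤ |x| ≤ 1` (valuations of different parity do not cancel), so `|β| ≤ exp(1)`, hence `|β| ≤ 1` by evenness, and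
`|σx − x| = |β|·|ϖ|^d`. [cite: Serre1979, Ch. IV §1 Prop. 4] -/
theorem v_map_sub_self_le_pow_of_even (hσ : ∀ x, σ (σ x) = x) (hϖ : Valued.v ϖ = WithZero.exp (-1 : ℤ))
    (heven : ∀ x : K, σ x = x → x ≠ 0 → ∃ n : ℤ, Valued.v x = WithZero.exp (2 * n))
    (hd : Valued.v (ϖ - σ ϖ) = Valued.v ϖ ^ d) {x : K} (hx : Valued.v x ≤ 1) : Valued.v (σ x - x) ≤ Valued.v ϖ ^ d := by
  have hvd : Valued.v (ϖ - σ ϖ) = WithZero.exp (-(d : ℤ)) := by rw [hd, ← map_pow, v_uniformizer_pow hϖ]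
  have hδ0 : ϖ - σ ϖ ≠ 0 := fun h => by rw [h, map_zero] at hvd; exact WithZero.coe_ne_zero hvd.symm
  obtain ⟨β, hβδ, hσβ⟩ : ∃ β : K, β * (ϖ - σ ϖ) = x - σ x ∧ σ β = β :=
    ⟨(x - σ x) / (ϖ - σ ϖ), div_mul_cancel₀ _ hδ0, by
      rw [map_div₀, map_sub, map_sub, hσ, hσ, ← neg_sub x (σ x), ← neg_sub ϖ (σ ϖ), neg_div_neg_eq]⟩
  set α : K := x - β * ϖ with hα
  have hσα : σ α = α := by
    rw [hα, map_sub, map_mul, hσβ]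
    linear_combination hβδ
  have hxdec : x = α + β * ϖ := by rw [hα]; ring
  have hsub : σ x - x = -(β * (ϖ - σ ϖ)) := by rw [hβδ, neg_sub]
  rw [hsub, Valuation.map_neg, map_mul, hd]
  by_cases hβ0 : β = 0
  · rw [hβ0, map_zero, zero_mul]; exact zero_le
  obtain ⟨n, hn⟩ := heven β hσβ hβ0
  have hβϖ : Valued.v (β * ϖ) = WithZero.exp (2 * n - 1) := by rw [map_mul, hn, hϖ, ← WithZero.exp_add]; ring_nf
  have hle : Valued.v (β * ϖ) ≤ 1 := by
    by_cases hα0 : α = 0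
    · rw [hxdec, hα0, zero_add] at hx; exact hx
    · obtain ⟨m, hm⟩ := heven α hσα hα0
      have hne : Valued.v α ≠ Valued.v (β * ϖ) := by
        rw [hm, hβϖ]
        intro h
        have := WithZero.exp_injective h
        omega
      have hmax := Valuation.map_add_of_distinct_val Valued.v hne
      rw [← hxdec] at hmax
      rw [hmax] at hx
      exact le_trans (le_max_right _ _) hx
  rw [hβϖ, ← WithZero.exp_zero, WithZero.exp_le_exp] at hle
  have hβ1 : Valued.v β ≤ 1 := by rw [hn, ← WithZero.exp_zero, WithZero.exp_le_exp]; omega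
  exact mul_le_of_le_one_left' hβ1

/-! ## §2 The head: `d` and `t` are uniformiser-free -/

/-- **`|ϖ′ − σϖ′| = |ϖ − σϖ|` FOR ANY TWO UNIFORMISERS** under evenness and `|ϖ − σϖ| = |ϖ|^d`: `ϖ′ = uϖ`, `ϖ′ − σϖ′ = u(ϖ − σϖ) + σϖ·(u − σu)` with `|u − σu| ≤ |ϖ|^d` (§1), so
the second term is strictly smaller than the first. [cite: Serre1979, Ch. III §6 Prop. 13 and Remark] -/
theorem v_sub_map_eq_of_uniformizer (hσ : ∀ x, σ (σ x) = x) (hvσ : ∀ a, Valued.v (σ a) = Valued.v a) (hϖ : Valued.v ϖ = WithZero.exp (-1 : ℤ))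
    (heven : ∀ x : K, σ x = x → x ≠ 0 → ∃ n : ℤ, Valued.v x = WithZero.exp (2 * n))
    (hd : Valued.v (ϖ - σ ϖ) = Valued.v ϖ ^ d) {ϖ' : K} (hϖ' : Valued.v ϖ' = WithZero.exp (-1 : ℤ)) :
    Valued.v (ϖ' - σ ϖ') = Valued.v (ϖ - σ ϖ) := by
  have hϖ0 : ϖ ≠ 0 := uniformizer_ne_zero hϖ
  have hvd : Valued.v (ϖ - σ ϖ) = WithZero.exp (-(d : ℤ)) := by rw [hd, ← map_pow, v_uniformizer_pow hϖ]
  set u : K := ϖ' / ϖ with hu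
  have hvu : Valued.v u = 1 := by rw [hu, map_div₀, hϖ', hϖ, div_self (WithZero.coe_ne_zero)]
  have hϖ'u : ϖ' = u * ϖ := by rw [hu, div_mul_cancel₀ _ hϖ0]
  have hdec : ϖ' - σ ϖ' = u * (ϖ - σ ϖ) + σ ϖ * (u - σ u) := by rw [hϖ'u, map_mul]; ring
  have h1 : Valued.v (u * (ϖ - σ ϖ)) = WithZero.exp (-(d : ℤ)) := by rw [map_mul, hvu, one_mul, hvd]
  have h2 : Valued.v (σ ϖ * (u - σ u)) < Valued.v (u * (ϖ - σ ϖ)) := by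
    rw [h1, map_mul, hvσ, hϖ, ← neg_sub, Valuation.map_neg]
    calc WithZero.exp (-1 : ℤ) * Valued.v (σ u - u) ≤ WithZero.exp (-1 : ℤ) * Valued.v ϖ ^ d :=
          mul_le_mul' le_rfl (v_map_sub_self_le_pow_of_even hσ hϖ heven hd hvu.le)
      _ = WithZero.exp (-1 - (d : ℤ)) := by rw [← map_pow, v_uniformizer_pow hϖ, ← WithZero.exp_add]; ring_nf
      _ < WithZero.exp (-(d : ℤ)) := WithZero.exp_lt_exp.2 (by omega)
  rw [hdec, Valuation.map_add_eq_of_lt_left _ h2, h1, hvd]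

/-- **THE DATUM IS INTRINSIC — `stub_U0_d_t_unique`'s statement, PROVED**: two ramified quadratic data `(σ, ϖ, d, t)`, `(σ, ϖ′, d′, t′)` for the same involution have `d = d′`
and `t = t′` (`|2|` pins `t`; §2 pins `|ϖ − σϖ| = exp(−d)`).  Dealer #12 clause; ref4 R4-71 (T1). [cite: Serre1979, Ch. III §6 Prop. 13 and Remark; Ch. IV §1 Prop. 4] -/
theorem d_t_unique :
    ∀ {K : Type} [Field K] [Valued K ℤᵐ⁰] (σ : K →+* K) (ϖ ϖ' : K) (d t d' t' : ℕ),
      IsRamifiedQuadraticDatum σ ϖ d t → IsRamifiedQuadraticDatum σ ϖ' d' t' → d = d' ∧ t = t' := by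
  intro K _ _ σ ϖ ϖ' d t d' t' hD hD'
  obtain ⟨hσ, hvσ, hϖ, heven, hd, -, h2⟩ := hD
  obtain ⟨-, -, hϖ', -, hd', -, h2'⟩ := hD'
  constructor
  · have h := v_sub_map_eq_of_uniformizer hσ hvσ hϖ heven hd hϖ'
    rw [hd', hd, ← map_pow, ← map_pow, v_uniformizer_pow hϖ', v_uniformizer_pow hϖ] at h
    have := WithZero.exp_injective h
    omega
  · rw [h2, ← map_pow, ← map_pow, v_uniformizer_pow hϖ, v_uniformizer_pow hϖ'] at h2'
    have := WithZero.exp_injective h2'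
    omega

end Summit.HodgeConjecture.HodgeConjecture.Cruxes.H413.F0P3cDyRamU0DatumUnique

end
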